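import Mathlib
import Literature.Analysis.FluidPDE.VorticityCalculus
import Summits.NavierStokesRegularity.NavierStokesRegularity.Theorems.ThreadingFluxHorizonTowerDefs
import HarnessLib

/-!
# Crux `PoloidalLiouville` (stmt-NavierStokesRegularity-1222, W1), crux idea «horizon-threading-tower» (ns-idea-15):
# AFFINE BLOW-DOWN SCALING — layer (B) of the blow-down programme for `OrderTwoHorizonLawBlowdown`

Support file (`--supports stmt-NavierStokesRegularity-1222`, helper).  Experiment cell `ns-wall-extremal`, width hand
ns-wall-eng-4 g4 (director-ns ruling 02:19:01Z (b)).  0 kit.  Pure calculus of the blow-down substitution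
`A y = x₀ + c • y` (`c : ℝ`): for `f` differentiable (resp. `C²`) at `A y`,

* `Scaling.hasFDerivAt_comp_affine` / `fderiv_comp_affine` — `D(f ∘ A)(y) = c • Df(A y)`;
* `Scaling.gradient_comp_affine` — `∇(φ ∘ A)(y) = c • ∇φ(A y)`;
* `Scaling.curl_comp_affine` — `curl (f ∘ A)(y) = c • (curl f)(A y)`;  `divergence_comp_affine` likewise;
* `Scaling.laplacian_comp_affine` — `Δ(f ∘ A)(y) = c² • (Δ f)(A y)`;
* function forms `curl_comp_affine_fun`, `laplacian_comp_affine_fun` (global `C¹` / `C²` data) and the INVERSE forms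
  `curl_affine_inv` / `laplacian_affine_inv` (`c ≠ 0`): `(curl f) ∘ A = c⁻¹ • curl (f ∘ A)`, `(Δ f) ∘ A = c⁻² • Δ (f ∘ A)` —
  the direction used to rewrite `Loc₂[u(t₀)]` at `x₀ + λₖ z` in the blow-down variables (layer (C));
* `Scaling.contDiff_comp_affine` — regularity is preserved.

HONEST FRAME: toolkit; `PoloidalLiouville` (1222) and NS regularity stay OPEN.
-/

-- the summit and its single problem share the name (D-0017 nested layout)
set_option linter.dupNamespace false

noncomputable section

namespace Summit.NavierStokesRegularity.NavierStokesRegularity.Theorems.PoloidalLiouville.HorizonTower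

open Set Function Filter Topology Metric
open scoped Topology RealInnerProductSpace Laplacian ContDiff
open Literature.Analysis.FluidPDE

namespace Scaling

variable {F : Type*} [NormedAddCommGroup F] [NormedSpace ℝ F]

/-- The affine map `y ↦ x₀ + c • y` has derivative `c • id`. -/
theorem hasFDerivAt_affine (x₀ : E3) (c : ℝ) (y : E3) :
    HasFDerivAt (fun z : E3 => x₀ + c • z) (c • ContinuousLinearMap.id ℝ E3) y :=
  ((hasFDerivAt_id y).const_smul c).const_add x₀

/-- The affine map is smooth. -/
theorem contDiff_affine (x₀ : E3) (c : ℝ) {n : WithTop ℕ∞} : ContDiff ℝ n (fun z : E3 => x₀ + c • z) :=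
  contDiff_const.add (contDiff_id.const_smul c)

/-- Regularity is preserved by the blow-down substitution. -/
theorem contDiff_comp_affine {f : E3 → F} {n : WithTop ℕ∞} (hf : ContDiff ℝ n f) (x₀ : E3) (c : ℝ) :
    ContDiff ℝ n (fun y : E3 => f (x₀ + c • y)) :=
  hf.comp (contDiff_affine x₀ c)

/-- **Chain rule** `D(f ∘ A)(y) = c • Df(A y)`. -/
theorem hasFDerivAt_comp_affine {f : E3 → F} {x₀ : E3} {c : ℝ} {y : E3}
    (hf : DifferentiableAt ℝ f (x₀ + c • y)) :
    HasFDerivAt (fun z : E3 => f (x₀ + c • z)) (c • fderiv ℝ f (x₀ + c • y)) y := by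
  have h := hf.hasFDerivAt.comp y (hasFDerivAt_affine x₀ c y)
  have e : (fderiv ℝ f (x₀ + c • y)).comp (c • ContinuousLinearMap.id ℝ E3) = c • fderiv ℝ f (x₀ + c • y) := by
    ext v; simp
  rw [e] at h
  exact h

/-- `fderiv` form of the chain rule. -/
theorem fderiv_comp_affine {f : E3 → F} {x₀ : E3} {c : ℝ} {y : E3} (hf : DifferentiableAt ℝ f (x₀ + c • y)) :
    fderiv ℝ (fun z : E3 => f (x₀ + c • z)) y = c • fderiv ℝ f (x₀ + c • y) :=
  (hasFDerivAt_comp_affine hf).fderiv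

/-- Gradients: `∇(φ ∘ A)(y) = c • ∇φ(A y)`. -/
theorem gradient_comp_affine {φ : E3 → ℝ} {x₀ : E3} {c : ℝ} {y : E3} (hφ : DifferentiableAt ℝ φ (x₀ + c • y)) :
    gradient (fun z : E3 => φ (x₀ + c • z)) y = c • gradient φ (x₀ + c • y) := by
  rw [gradient, fderiv_comp_affine hφ, map_smul, gradient]

/-- Curls: `curl (f ∘ A)(y) = c • (curl f)(A y)`. -/
theorem curl_comp_affine {f : E3 → E3} {x₀ : E3} {c : ℝ} {y : E3} (hf : DifferentiableAt ℝ f (x₀ + c • y)) :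
    curl (fun z : E3 => f (x₀ + c • z)) y = c • curl f (x₀ + c • y) := by
  rw [curl_eq_curlCLM, fderiv_comp_affine hf, map_smul, ← curl_eq_curlCLM]

/-- Divergences: `div (f ∘ A)(y) = c • (div f)(A y)`. -/
theorem divergence_comp_affine {f : E3 → E3} {x₀ : E3} {c : ℝ} {y : E3} (hf : DifferentiableAt ℝ f (x₀ + c • y)) :
    VectorCalculus.divergence (fun z : E3 => f (x₀ + c • z)) y = c * VectorCalculus.divergence f (x₀ + c • y) := by
  unfold VectorCalculus.divergence
  rw [fderiv_comp_affine hf, ContinuousLinearMap.toLinearMap_smul, map_smul, smul_eq_mul]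

/-- Second derivatives: `D²(f ∘ A)(y)[e][e'] = c² • D²f(A y)[e][e']` (for `f` of class `C²` near `A y`, stated with global
`C²` data for simplicity). -/
theorem fderiv_fderiv_comp_affine {f : E3 → F} (hf : ContDiff ℝ 2 f) (x₀ : E3) (c : ℝ) (y e e' : E3) :
    fderiv ℝ (fderiv ℝ (fun z : E3 => f (x₀ + c • z))) y e e' = (c * c) • fderiv ℝ (fderiv ℝ f) (x₀ + c • y) e e' := by
  have hfd : ∀ x, DifferentiableAt ℝ f x := fun x => hf.differentiable (by norm_cast) x
  have hDfd : ∀ x, DifferentiableAt ℝ (fderiv ℝ f) x := fun x =>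
    (hf.fderiv_right (m := 1) (by norm_cast)).differentiable (by simp) x
  have hfun : fderiv ℝ (fun z : E3 => f (x₀ + c • z)) = fun z => c • fderiv ℝ f (x₀ + c • z) :=
    funext fun z => fderiv_comp_affine (hfd _)
  have h2 : HasFDerivAt (fderiv ℝ (fun z : E3 => f (x₀ + c • z)))
      (c • (c • fderiv ℝ (fderiv ℝ f) (x₀ + c • y))) y := by
    rw [hfun]
    exact (hasFDerivAt_comp_affine (hDfd _)).const_smul c
  rw [h2.fderiv]
  simp only [smul_apply, smul_smul]

/-- Laplacians: `Δ(f ∘ A)(y) = c² • (Δ f)(A y)`. -/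
theorem laplacian_comp_affine {f : E3 → F} (hf : ContDiff ℝ 2 f) (x₀ : E3) (c : ℝ) (y : E3) :
    (Δ (fun z : E3 => f (x₀ + c • z))) y = (c * c) • (Δ f) (x₀ + c • y) := by
  set e : OrthonormalBasis (Fin 3) ℝ E3 := EuclideanSpace.basisFun (Fin 3) ℝ with he
  have hΔ : ∀ (g : E3 → F) (x : E3), (Δ g) x = ∑ i, fderiv ℝ (fderiv ℝ g) x (e i) (e i) := fun g x => by
    rw [InnerProductSpace.laplacian_eq_iteratedFDeriv_orthonormalBasis g e]
    exact Finset.sum_congr rfl fun i _ => by rw [iteratedFDeriv_two_apply]; rfl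
  rw [hΔ, hΔ, Finset.smul_sum]
  exact Finset.sum_congr rfl fun i _ => fderiv_fderiv_comp_affine hf x₀ c y (e i) (e i)

/-! ### Function forms and inverse forms -/

/-- `curl (f ∘ A) = c • (curl f) ∘ A` as functions, for `f` differentiable everywhere. -/
theorem curl_comp_affine_fun {f : E3 → E3} (hf : Differentiable ℝ f) (x₀ : E3) (c : ℝ) :
    curl (fun z : E3 => f (x₀ + c • z)) = fun y => c • curl f (x₀ + c • y) :=
  funext fun _ => curl_comp_affine (hf _)

/-- `Δ (f ∘ A) = c² • (Δ f) ∘ A` as functions, for `f` of class `C²`. -/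
theorem laplacian_comp_affine_fun {f : E3 → F} (hf : ContDiff ℝ 2 f) (x₀ : E3) (c : ℝ) :
    Δ (fun z : E3 => f (x₀ + c • z)) = fun y => (c * c) • (Δ f) (x₀ + c • y) :=
  funext fun y => laplacian_comp_affine hf x₀ c y

/-- INVERSE FORM for the curl (`c ≠ 0`): `(curl f)(A y) = c⁻¹ • curl (f ∘ A)(y)`. -/
theorem curl_affine_inv {f : E3 → E3} (hf : Differentiable ℝ f) (x₀ : E3) {c : ℝ} (hc : c ≠ 0) (y : E3) :
    curl f (x₀ + c • y) = c⁻¹ • curl (fun z : E3 => f (x₀ + c • z)) y := by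
  rw [curl_comp_affine (hf _), smul_smul, inv_mul_cancel₀ hc, one_smul]

/-- INVERSE FORM for the Laplacian (`c ≠ 0`): `(Δ f)(A y) = c⁻² • Δ (f ∘ A)(y)`. -/
theorem laplacian_affine_inv {f : E3 → F} (hf : ContDiff ℝ 2 f) (x₀ : E3) {c : ℝ} (hc : c ≠ 0) (y : E3) :
    (Δ f) (x₀ + c • y) = (c * c)⁻¹ • (Δ (fun z : E3 => f (x₀ + c • z))) y := by
  rw [laplacian_comp_affine hf, smul_smul, inv_mul_cancel₀ (mul_ne_zero hc hc), one_smul]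

/-- INVERSE FORM for the derivative (`c ≠ 0`): `Df(A y) = c⁻¹ • D(f ∘ A)(y)`. -/
theorem fderiv_affine_inv {f : E3 → F} (hf : Differentiable ℝ f) (x₀ : E3) {c : ℝ} (hc : c ≠ 0) (y : E3) :
    fderiv ℝ f (x₀ + c • y) = c⁻¹ • fderiv ℝ (fun z : E3 => f (x₀ + c • z)) y := by
  rw [fderiv_comp_affine (hf _), smul_smul, inv_mul_cancel₀ hc, one_smul]

/-- INVERSE FORM for the gradient (`c ≠ 0`). -/
theorem gradient_affine_inv {φ : E3 → ℝ} (hφ : Differentiable ℝ φ) (x₀ : E3) {c : ℝ} (hc : c ≠ 0) (y : E3) :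
    gradient φ (x₀ + c • y) = c⁻¹ • gradient (fun z : E3 => φ (x₀ + c • z)) y := by
  rw [gradient_comp_affine (hφ _), smul_smul, inv_mul_cancel₀ hc, one_smul]

end Scaling

end Summit.NavierStokesRegularity.NavierStokesRegularity.Theorems.PoloidalLiouville.HorizonTower

end
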